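import Literature.NumberTheory.Transcendental.TrdegZariskiDimConverse
import Literature.NumberTheory.Transcendental.GenericPointTranscendence

/-!
# Route `RigidCore`, crux (S*) `MinimalCounterexampleInAcl` (stmt-Schanuel-0969): relation ideals of points of
ℚ-curves are minimal primes

Commutative algebra behind the equivalence "rank-2 residue of the line `kernel-arithmetic-selection` ⟺
`SparsityTwo`" (file `RigidCoreMinimalCounterexampleInAclResidues.lean`):

* `ker_aeval_eq_of_prime_le`, `ker_aeval_mem_minimalPrimes` — for an ideal `J ⊆ ℚ[X_ι]` whose complex zero
  set has dimension `≤ 1` and a point `w ∈ Z_ℂ(J)` with SOME transcendental coordinate, the relation ideal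
  `P_w = ker (aeval w) ⊆ ℚ[X_ι]` is a minimal prime over `J`: a prime `J ≤ 𝔭 < P_w` would carry, at the
  generic point `ζ` of `𝔭` (coordinates in `Frac(ℚ[X] ⧸ 𝔭)`, `aeval_genericCoords_eq_zero_iff`), the two
  algebraically independent functions `ζ_i` and `f(ζ)`, `f ∈ P_w ∖ 𝔭`, against
  `not_algebraicIndependent_pair_of_aeval_eq_zero` (tree, Görtz–Wedhorn I Prop. 5.38); the dependence
  relation, normalised to a non-zero constant coefficient (`exists_coeff_zero_ne_zero_of_isAlgebraic`),
  descends through `𝔭 ≤ P_w` to an algebraic relation for the transcendental coordinate `w i`.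
* small tool: `withBot_enat_le_one_of_lt_two` (dimension bookkeeping `dim < 2 ⇒ dim ≤ 1`).

## References

* U. Görtz, T. Wedhorn, *Algebraic Geometry I*, 2nd ed. (2020), Prop. 5.38 (dimension and base change).
* H. Matsumura, *Commutative Ring Theory*, CUP 1986, Thm 5.6 (dimension = transcendence degree).
-/

noncomputable section

set_option linter.dupNamespace false

open Set MvPolynomial
open Literature.NumberTheory.Transcendental

namespace Summit.Schanuel.Schanuel.Theorems

/-! ## Commutative algebra: relation ideals of exponential points are minimal primes -/

/-- An algebraic element which is non-zero in a field satisfies a polynomial relation with NON-ZERO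
constant coefficient (divide a relation of least degree by the variable). [folklore] -/
theorem exists_coeff_zero_ne_zero_of_isAlgebraic {R K : Type*} [CommRing R] [Field K] [Algebra R K]
    {c : K} (hc : c ≠ 0) (h : IsAlgebraic R c) :
    ∃ q : Polynomial R, q.coeff 0 ≠ 0 ∧ Polynomial.aeval c q = 0 := by
  obtain ⟨q, hq0, hqc⟩ := h
  induction hn : q.natDegree using Nat.strong_induction_on generalizing q with
  | _ n ih =>
    by_cases h0 : q.coeff 0 = 0
    · have hq : q.divX * Polynomial.X = q := by
        have := Polynomial.divX_mul_X_add q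
        rwa [h0, map_zero, add_zero] at this
      have hdx0 : q.divX ≠ 0 := by
        intro h
        apply hq0
        rw [← hq, h, zero_mul]
      have hn0 : n ≠ 0 := by
        rintro rfl
        apply hq0
        rw [Polynomial.eq_C_of_natDegree_eq_zero hn, h0, map_zero]
      have hdeg : q.divX.natDegree < n := by
        rw [Polynomial.natDegree_divX_eq_natDegree_tsub_one, hn]
        omega
      have hroot : Polynomial.aeval c q.divX = 0 := by
        have : Polynomial.aeval c q.divX * c = 0 := by
          have e : Polynomial.aeval c (q.divX * Polynomial.X) = Polynomial.aeval c q.divX * c := by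
            rw [map_mul, Polynomial.aeval_X]
          rw [← e, hq, hqc]
        exact (mul_eq_zero.1 this).resolve_right hc
      exact ih _ hdeg q.divX hdx0 hroot rfl
    · exact ⟨q, h0, hqc⟩

/-- The coordinates of the generic point of `Z(𝔭)`, `𝔭` a prime of `ℚ[X_ι]`, in the fraction field of
`ℚ[X_ι] ⧸ 𝔭` evaluate a polynomial to zero iff it lies in `𝔭`. [folklore] -/
theorem aeval_genericCoords_eq_zero_iff {ι : Type*} (𝔭 : Ideal (MvPolynomial ι ℚ)) [𝔭.IsPrime]
    (g : MvPolynomial ι ℚ) :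
    MvPolynomial.aeval (fun i => algebraMap (MvPolynomial ι ℚ ⧸ 𝔭) (FractionRing (MvPolynomial ι ℚ ⧸ 𝔭))
        (Ideal.Quotient.mk 𝔭 (X i))) g = 0 ↔ g ∈ 𝔭 := by
  set B := MvPolynomial ι ℚ ⧸ 𝔭
  set K := FractionRing B
  let ψ : MvPolynomial ι ℚ →ₐ[ℚ] K := ((algebraMap B K).comp (Ideal.Quotient.mk 𝔭)).toRatAlgHom
  have hψ : MvPolynomial.aeval (fun i => algebraMap B K (Ideal.Quotient.mk 𝔭 (X i))) = ψ :=
    MvPolynomial.algHom_ext fun i => by simp [ψ]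
  rw [hψ]
  change algebraMap B K (Ideal.Quotient.mk 𝔭 g) = 0 ↔ g ∈ 𝔭
  rw [map_eq_zero_iff _ (IsFractionRing.injective B K), Ideal.Quotient.eq_zero_iff_mem]

/-- **No prime strictly between `J` and the relation ideal of a point with a transcendental coordinate,
when `dim Z_ℂ(J) ≤ 1`.**  Let `J ⊆ ℚ[X_ι]` with `dim ℂ[X] ⧸ I(Z_ℂ(J)) ≤ 1`, `w ∈ ℂ^ι` with some coordinate
`w i` transcendental, and `𝔭` a prime with `J ≤ 𝔭 ≤ P_w := ker (aeval w)`.  Then `𝔭 = P_w`.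
(At the generic point `ζ` of `𝔭` the coordinate `ζ_i` is transcendental — a relation would descend to
`w i` through `𝔭 ≤ P_w` — so an `f ∈ P_w ∖ 𝔭` gives `f(ζ) ≠ 0` algebraic over `ℚ[ζ_i]`
(`not_algebraicIndependent_pair_of_aeval_eq_zero`); a relation `Σ r_j(ζ_i) f(ζ)^j = 0` with `r₀ ≠ 0`
lies in `𝔭 ≤ P_w`, and at `w` it reads `r₀(w i) = 0`, contradicting transcendence of `w i`.)
[cite: GortzWedhorn2020, Prop. 5.38] -/
theorem ker_aeval_eq_of_prime_le {ι : Type} [Finite ι] (J : Ideal (MvPolynomial ι ℚ))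
    (hdim : ringKrullDim (MvPolynomial ι ℂ ⧸ vanishingIdeal ℂ (zeroLocus ℂ J)) ≤ 1)
    (w : ι → ℂ) {i : ι} (hi : Transcendental ℚ (w i))
    {𝔭 : Ideal (MvPolynomial ι ℚ)} (h𝔭 : 𝔭.IsPrime) (hJ𝔭 : J ≤ 𝔭)
    (h𝔭P : 𝔭 ≤ RingHom.ker (MvPolynomial.aeval w : MvPolynomial ι ℚ →ₐ[ℚ] ℂ)) :
    𝔭 = RingHom.ker (MvPolynomial.aeval w : MvPolynomial ι ℚ →ₐ[ℚ] ℂ) := by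
  classical
  refine le_antisymm h𝔭P fun f hf => ?_
  rw [RingHom.mem_ker] at hf
  by_contra hf𝔭
  haveI := h𝔭
  set B := MvPolynomial ι ℚ ⧸ 𝔭
  set K := FractionRing B
  set ζ : ι → K := fun j => algebraMap B K (Ideal.Quotient.mk 𝔭 (X j : MvPolynomial ι ℚ)) with hζdef
  have hker : ∀ g : MvPolynomial ι ℚ, MvPolynomial.aeval ζ g = 0 ↔ g ∈ 𝔭 :=
    aeval_genericCoords_eq_zero_iff 𝔭
  have hmemP : ∀ g ∈ 𝔭, MvPolynomial.aeval w g = 0 := fun g hg => (RingHom.mem_ker).1 (h𝔭P hg)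
  -- `ζ` is a zero of `J`
  have hζJ : ∀ g ∈ J, MvPolynomial.aeval ζ g = 0 := fun g hg => (hker g).2 (hJ𝔭 hg)
  -- the two polynomial functions of `ζ`
  set a : K := ζ i with ha_def
  set c : K := MvPolynomial.aeval ζ f with hc_def
  have hc : c ≠ 0 := fun h => hf𝔭 ((hker f).1 h)
  have ha_eq : MvPolynomial.aeval ζ (X i : MvPolynomial ι ℚ) = a := MvPolynomial.aeval_X _ _
  -- `a` is transcendental over `ℚ`
  have ha : Transcendental ℚ a := by
    rintro ⟨μ, hμ0, hμa⟩
    apply hi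
    refine ⟨μ, hμ0, ?_⟩
    have hg : MvPolynomial.aeval ζ (Polynomial.aeval (X i : MvPolynomial ι ℚ) μ) = 0 := by
      rw [← Polynomial.aeval_algHom_apply, ha_eq, hμa]
    have hgw := hmemP _ ((hker _).1 hg)
    rwa [← Polynomial.aeval_algHom_apply, MvPolynomial.aeval_X] at hgw
  -- dependence of `(c, a)` from `dim ≤ 1`
  have hfun : (fun j => MvPolynomial.aeval ζ (![f, X i] j)) = ![c, a] := by
    funext j
    fin_cases j
    · rfl
    · simp [ha_eq]
  have hdep : ¬ AlgebraicIndependent ℚ ![c, a] := by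
    have := not_algebraicIndependent_pair_of_aeval_eq_zero (F := ℂ) J hdim ζ hζJ ![f, X i]
    rw [hfun] at this
    exact this
  -- hence `c` is algebraic over `ℚ[a]`
  have hai : AlgebraicIndependent ℚ ![a] := algebraicIndependent_iff_transcendental.2 ha
  have halg : IsAlgebraic (Algebra.adjoin ℚ (Set.range ![a])) c := by
    have hF : ¬ AlgebraicIndependent ℚ (fun o : Option (Fin 1) => o.elim c ![a]) := by
      intro h
      apply hdep
      refine (algebraicIndependent_equiv' (finSuccEquiv 1).symm ?_).1 h
      funext o
      cases o with
      | none => simp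
      | some j =>
        fin_cases j
        simp
    rw [AlgebraicIndependent.option_iff] at hF
    push Not at hF
    unfold Transcendental at hF
    simpa using hF hai
  -- a relation with non-zero constant coefficient, coefficients written as polynomials in `a`
  obtain ⟨q, hq0, hqc⟩ := exists_coeff_zero_ne_zero_of_isAlgebraic hc halg
  have hrange : Set.range ![a] = {a} := by
    ext y
    simp
  have hcoeff : ∀ j : ℕ, ∃ r : Polynomial ℚ, Polynomial.aeval a r = ((q.coeff j : _) : K) := by
    intro j
    have hm : ((q.coeff j : _) : K) ∈ Algebra.adjoin ℚ ({a} : Set K) := by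
      rw [← hrange]
      exact (q.coeff j).2
    rw [Algebra.adjoin_singleton_eq_range_aeval] at hm
    exact (AlgHom.mem_range _).1 hm
  choose r hr using hcoeff
  -- transport the relation into `ℚ[X_ι]`
  set G : MvPolynomial ι ℚ :=
    ∑ j ∈ Finset.range (q.natDegree + 1), Polynomial.aeval (X i : MvPolynomial ι ℚ) (r j) * f ^ j
    with hG_def
  have hGζ : MvPolynomial.aeval ζ G = Polynomial.aeval c q := by
    rw [Polynomial.aeval_eq_sum_range, hG_def, map_sum]
    refine Finset.sum_congr rfl fun j _ => ?_
    rw [map_mul, map_pow, ← Polynomial.aeval_algHom_apply, ha_eq, hr j, Algebra.smul_def]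
    rfl
  have hG𝔭 : G ∈ 𝔭 := (hker G).1 (by rw [hGζ, hqc])
  have hGw : MvPolynomial.aeval w G = Polynomial.aeval (w i) (r 0) := by
    rw [hG_def, map_sum]
    rw [Finset.sum_eq_single 0]
    · rw [map_mul, pow_zero, map_one, mul_one, ← Polynomial.aeval_algHom_apply, MvPolynomial.aeval_X]
    · intro j _ hj
      rw [map_mul, map_pow, hf, zero_pow hj, mul_zero]
    · intro h
      exact absurd (Finset.mem_range.2 (Nat.succ_pos _)) h
  have hr0 : Polynomial.aeval (w i) (r 0) = 0 := by rw [← hGw]; exact hmemP G hG𝔭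
  have hr00 : r 0 = 0 := by
    by_contra hne
    exact hi ⟨r 0, hne, hr0⟩
  apply hq0
  have : ((q.coeff 0 : _) : K) = 0 := by rw [← hr 0, hr00, map_zero]
  exact ZeroMemClass.coe_eq_zero.1 this

/-- **The relation ideal of an exponential point with a transcendental coordinate is a minimal prime.**
For `J ⊆ ℚ[X_ι]` with `dim Z_ℂ(J) ≤ 1` and `w ∈ Z_ℂ(J)` with some `w i` transcendental, the prime
`P_w = ker (aeval w)` is a minimal prime over `J`. [cite: GortzWedhorn2020, Prop. 5.38] -/
theorem ker_aeval_mem_minimalPrimes : ∀ {ι : Type} [Finite ι] (J : Ideal (MvPolynomial ι ℚ)), ringKrullDim (MvPolynomial ι ℂ ⧸ MvPolynomial.vanishingIdeal ℂ (MvPolynomial.zeroLocus ℂ J)) ≤ 1 → ∀ {w : ι → ℂ}, (∀ g ∈ J, MvPolynomial.aeval w g = 0) → ∀ {i : ι}, Transcendental ℚ (w i) → RingHom.ker (MvPolynomial.aeval w : MvPolynomial ι ℚ →ₐ[ℚ] ℂ) ∈ Ideal.minimalPrimes J := by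
  intro ι _ J hdim w hw i hi
  haveI : (RingHom.ker (MvPolynomial.aeval w : MvPolynomial ι ℚ →ₐ[ℚ] ℂ)).IsPrime :=
    RingHom.ker_isPrime _
  have hJP : J ≤ RingHom.ker (MvPolynomial.aeval w : MvPolynomial ι ℚ →ₐ[ℚ] ℂ) :=
    fun g hg => (RingHom.mem_ker).2 (hw g hg)
  obtain ⟨𝔭, h𝔭, h𝔭P⟩ := Ideal.exists_minimalPrimes_le hJP
  rwa [ker_aeval_eq_of_prime_le J hdim w hi h𝔭.1.1 h𝔭.1.2 h𝔭P] at h𝔭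

/-- `x < 2 → x ≤ 1` in `WithBot ℕ∞` (dimension bookkeeping). [folklore] -/
theorem withBot_enat_le_one_of_lt_two {d : WithBot ℕ∞} (h : d < 2) : d ≤ 1 := by
  induction d using WithBot.recBotCoe with
  | bot => exact bot_le
  | coe e =>
    have h' : e < 2 := WithBot.coe_lt_coe.1 h
    have h'' : e ≤ 1 := ENat.lt_two_iff.1 h'
    exact WithBot.coe_le_coe.2 h''

end Summit.Schanuel.Schanuel.Theorems

end
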